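import Literature.Barriers.ValiantsHypothesis.KroneckerXRayMachineDecode
import HarnessLib

/-!
# The simplex embedding `2D-X-RAY → KRONECKER` on codes, II: the admissibility test

Second machine file towards `FischerIkenmeyer2020_xrayToKronecker_mem_FP`. On a code
`w = encode (μ', ν', ρ')` (three unary lists; `canonXF`, file I) the map `xrayToKronecker` embeds
the instance only if it is ADMISSIBLE (`XRayAdmissible r μ' ν' ρ'` with `r + 1 = |μ'|`,
`KroneckerXRayEmbedding.lean`: equal lengths, equal sums, the first-moment identity
`∑ i (μ'_i + ν'_i + ρ'_i) = r |μ'|`, and weakly decreasing lifted marginals `X, Y, Z`). This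
file decides admissibility in polynomial time:

* `admissibleF`, a conjunction of one-bit bricks: header `1^{|μ'|}` non-empty; the three headers
  equal; the three item sections of equal length (for codes: `|items| = 2 ∑ + 2 n`, so equal
  sums); the moment identity, both sides computed in unary by indexed folds (`momF`, `sumAF`);
  antitonicity of `X`, `Y`, `Z` as the finite tests `μ'_{i+1} ≤ μ'_i + (r - i)` for `i < r`
  (`antiF k`, a fold collecting violation marks, `tri (r-i) = tri (r-i-1) + (r-i)`);
* `admissibleF_mem_FP`, `oneBit_admissibleF` and **`admissibleF_encode_eq_true_iff :
  admissibleF (encode (μ', ν', ρ')) = [true] ↔ XRayAdmissible (|μ'| - 1) μ' ν' ρ'`**.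

## References

* [FischerIkenmeyer2020] N. Fischer, C. Ikenmeyer, Comput. Complexity 29 (2020) 8, Thm. 5 ("not
  trivially unsatisfiable": the hypotheses of the embedding).
* [AroraBarak2009] S. Arora, B. Barak, *Computational Complexity*, CUP 2009, §1.3.
-/

noncomputable section

namespace Literature.Barriers.ValiantsHypothesis

namespace XRayKron

open _root_.Computability Polynomial Finset Literature.Computability.Complexity Literature.Computability.Complexity.Brick
  Literature.Computability.Complexity.Ladder3 Literature.Computability.Complexity.HashBricks
  Literature.Computability.Complexity.Plumb Literature.Computability.Complexity.OneInThree
  Literature.NumberTheory.DiophantineGeometry Literature.Combinatorics.Enumerative.Tomography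

/-! ### Accessors of a word and of a piece argument `⟨w, 1ⁱ⟩` -/

/-- The three list codes of a word. [folklore] -/
def z1F : List Bool → List Bool := fstF
/-- Second list code. [folklore] -/
def z2F : List Bool → List Bool := fstF ∘ sndF
/-- Third list code. [folklore] -/
def z3F : List Bool → List Bool := sndF ∘ sndF

/-- The list code `k ∈ {1,2,3}` of a word. [folklore] -/
def zF (k : ℕ) : List Bool → List Bool := if k = 1 then z1F else if k = 2 then z2F else z3F

/-- `zF k ∈ FP`. [cite: AroraBarak2009, §1.3] -/
theorem zF_mem_FP (k : ℕ) : zF k ∈ FP := by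
  unfold zF z1F z2F z3F
  split_ifs
  · exact fstF_mem_FP
  · exact comp_mem_FP fstF_mem_FP sndF_mem_FP
  · exact comp_mem_FP sndF_mem_FP sndF_mem_FP

/-- The genuine word. [folklore] -/
def wordOf (a b c : List ℕ) : List Bool := encodingTwoDXRay.encode (a, b, c)

/-- The list `k` of a triple. [folklore] -/
def lst (k : ℕ) (a b c : List ℕ) : List ℕ := if k = 1 then a else if k = 2 then b else c

/-- Value of `lst`. [folklore] -/
@[simp] theorem lst_one (a b c : List ℕ) : lst 1 a b c = a := rfl
/-- Value of `lst`. [folklore] -/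
@[simp] theorem lst_two (a b c : List ℕ) : lst 2 a b c = b := rfl
/-- Value of `lst`. [folklore] -/
@[simp] theorem lst_three (a b c : List ℕ) : lst 3 a b c = c := rfl

/-- The genuine word, spelled out. [folklore] -/
theorem wordOf_eq (a b c : List ℕ) : wordOf a b c =
    boolPair (encodingUnaryListNat.encode a) (boolPair (encodingUnaryListNat.encode b) (encodingUnaryListNat.encode c)) := rfl

/-- Value of `z1F` on a genuine word. [folklore] -/
theorem z1F_wordOf (a b c : List ℕ) : z1F (wordOf a b c) = encodingUnaryListNat.encode a := by
  rw [wordOf_eq, z1F, fstF_boolPair]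

/-- Value of `z2F` on a genuine word. [folklore] -/
theorem z2F_wordOf (a b c : List ℕ) : z2F (wordOf a b c) = encodingUnaryListNat.encode b := by
  rw [wordOf_eq, z2F, Function.comp_apply, sndF_boolPair, fstF_boolPair]

/-- Value of `z3F` on a genuine word. [folklore] -/
theorem z3F_wordOf (a b c : List ℕ) : z3F (wordOf a b c) = encodingUnaryListNat.encode c := by
  rw [wordOf_eq, z3F, Function.comp_apply, sndF_boolPair, sndF_boolPair]

/-- Value of `zF k` on a genuine word. [folklore] -/
theorem zF_wordOf (k : ℕ) (a b c : List ℕ) : zF k (wordOf a b c) = encodingUnaryListNat.encode (lst k a b c) := by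
  unfold zF lst
  split_ifs
  · exact z1F_wordOf a b c
  · exact z2F_wordOf a b c
  · exact z3F_wordOf a b c

/-- On `⟨w, 1ⁱ⟩`: item `i` of list `k`. [folklore] -/
def itemP (k : ℕ) : List Bool → List Bool := nthItemFn ∘ fanoutFn sndF (sndF ∘ zF k ∘ fstF)
/-- On `⟨w, 1ⁱ⟩`: item `i + 1` of list `k`. [folklore] -/
def itemSuccP (k : ℕ) : List Bool → List Bool := nthItemFn ∘ fanoutFn (List.cons true ∘ sndF) (sndF ∘ zF k ∘ fstF)
/-- On a word: `1ʳ = header of list 1 without one symbol`. [folklore] -/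
def rF : List Bool → List Bool := dropFn ∘ fanoutFn (fun _ => [true]) (fstF ∘ z1F)
/-- On `⟨w, 1ⁱ⟩`: `1^{r - i}`. [folklore] -/
def rMinusIP : List Bool → List Bool := dropFn ∘ fanoutFn sndF (rF ∘ fstF)

/-- `itemP`: membership in `FP` by composition. [cite: AroraBarak2009, §1.3] -/
theorem itemP_mem_FP (k : ℕ) : itemP k ∈ FP :=
  comp_mem_FP nthItemFn_mem_FP (fanoutFn_mem_FP sndF_mem_FP (comp_mem_FP sndF_mem_FP (comp_mem_FP (zF_mem_FP k) fstF_mem_FP)))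
/-- `itemSuccP`: membership in `FP` by composition. [cite: AroraBarak2009, §1.3] -/
theorem itemSuccP_mem_FP (k : ℕ) : itemSuccP k ∈ FP :=
  comp_mem_FP nthItemFn_mem_FP (fanoutFn_mem_FP (comp_mem_FP (cons_mem_FP true) sndF_mem_FP)
    (comp_mem_FP sndF_mem_FP (comp_mem_FP (zF_mem_FP k) fstF_mem_FP)))
/-- `rF`: membership in `FP` by composition. [cite: AroraBarak2009, §1.3] -/
theorem rF_mem_FP : rF ∈ FP := comp_mem_FP dropFn_mem_FP (fanoutFn_mem_FP (const_mem_FP _) (comp_mem_FP fstF_mem_FP (zF_mem_FP 1)))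
/-- `rMinusIP`: membership in `FP` by composition. [cite: AroraBarak2009, §1.3] -/
theorem rMinusIP_mem_FP : rMinusIP ∈ FP := comp_mem_FP dropFn_mem_FP (fanoutFn_mem_FP sndF_mem_FP (comp_mem_FP rF_mem_FP fstF_mem_FP))

/-- The genuine piece argument. [folklore] -/
def pargOf (a b c : List ℕ) (i : ℕ) : List Bool := boolPair (wordOf a b c) (ones i)

/-- Value of `sndF`. [folklore] -/
@[simp] theorem sndF_pargOf (a b c : List ℕ) (i : ℕ) : sndF (pargOf a b c i) = ones i := sndF_boolPair _ _
/-- Value of `fstF`. [folklore] -/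
@[simp] theorem fstF_pargOf (a b c : List ℕ) (i : ℕ) : fstF (pargOf a b c i) = wordOf a b c := fstF_boolPair _ _

/-- Items of a list code read by `nthItemFn`, as `getD`. [folklore] -/
theorem nthItemFn_code (l : List ℕ) (i : ℕ) :
    nthItemFn (boolPair (ones i) (sndF (encodingUnaryListNat.encode l))) = ones (l.getD i 0) := by
  rw [encodeUnaryList_eq, sndF_boolPair, nthItemFn_encList, List.getD_eq_getElem?_getD, List.getElem?_map,
    List.getD_eq_getElem?_getD]
  cases l[i]? <;> rfl

/-- Value of `itemP`. [folklore] -/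
theorem itemP_pargOf (k : ℕ) (a b c : List ℕ) (i : ℕ) : itemP k (pargOf a b c i) = ones ((lst k a b c).getD i 0) := by
  simp only [itemP, Function.comp_apply, fanoutFn_apply, pargOf, sndF_boolPair, fstF_boolPair, zF_wordOf, nthItemFn_code]

/-- Value of `itemSuccP`. [folklore] -/
theorem itemSuccP_pargOf (k : ℕ) (a b c : List ℕ) (i : ℕ) :
    itemSuccP k (pargOf a b c i) = ones ((lst k a b c).getD (i + 1) 0) := by
  simp only [itemSuccP, Function.comp_apply, fanoutFn_apply, pargOf, sndF_boolPair, fstF_boolPair, zF_wordOf,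
    show true :: ones i = ones (i + 1) by simp [List.replicate_succ], nthItemFn_code]

/-- Value of `rF`. [folklore] -/
theorem rF_wordOf (a b c : List ℕ) : rF (wordOf a b c) = ones (a.length - 1) := by
  simp only [rF, Function.comp_apply, fanoutFn_apply, z1F_wordOf, encodeUnaryList_eq, fstF_boolPair, dropFn_boolPair,
    List.length_singleton, List.drop_replicate]

/-- Value of `rMinusIP`. [folklore] -/
theorem rMinusIP_pargOf (a b c : List ℕ) (i : ℕ) : rMinusIP (pargOf a b c i) = ones (a.length - 1 - i) := by
  simp only [rMinusIP, Function.comp_apply, fanoutFn_apply, pargOf, sndF_boolPair, fstF_boolPair, rF_wordOf,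
    dropFn_boolPair, List.length_replicate, List.drop_replicate]

/-! ### Initial records and generic fold values -/

/-- `⟨w, ⟨bin |μ'|, ⟨1⁰, ε⟩⟩⟩`. [folklore] -/
def initN : List Bool → List Bool := fanoutFn id (fanoutFn (lenBinF ∘ fstF ∘ z1F) (fun _ => boolPair (ones 0) []))
/-- `⟨w, ⟨bin r, ⟨1⁰, ε⟩⟩⟩`. [folklore] -/
def initR : List Bool → List Bool := fanoutFn id (fanoutFn (lenBinF ∘ rF) (fun _ => boolPair (ones 0) []))

/-- `initN`: membership in `FP` by composition. [cite: AroraBarak2009, §1.3] -/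
theorem initN_mem_FP : initN ∈ FP :=
  fanoutFn_mem_FP (PolyTimeComputable.id _) (fanoutFn_mem_FP (comp_mem_FP lenBinF_mem_FP (comp_mem_FP fstF_mem_FP (zF_mem_FP 1)))
    (const_mem_FP _))
/-- `initR`: membership in `FP` by composition. [cite: AroraBarak2009, §1.3] -/
theorem initR_mem_FP : initR ∈ FP :=
  fanoutFn_mem_FP (PolyTimeComputable.id _) (fanoutFn_mem_FP (comp_mem_FP lenBinF_mem_FP rF_mem_FP) (const_mem_FP _))

/-- Value of `initN`. [folklore] -/
theorem initN_wordOf (a b c : List ℕ) :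
    initN (wordOf a b c) = boolPair (wordOf a b c) (boolPair (encodeNat a.length) (boolPair (ones 0) [])) := by
  simp only [initN, fanoutFn_apply, id, Function.comp_apply, z1F_wordOf, encodeUnaryList_eq, fstF_boolPair, lenBinF_apply,
    List.length_replicate]

/-- Value of `initR`. [folklore] -/
theorem initR_wordOf (a b c : List ℕ) :
    initR (wordOf a b c) = boolPair (wordOf a b c) (boolPair (encodeNat (a.length - 1)) (boolPair (ones 0) [])) := by
  simp only [initR, fanoutFn_apply, id, Function.comp_apply, rF_wordOf, lenBinF_apply, List.length_replicate]

/-- A word is at least as long as the header of its first list. [folklore] -/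
theorem length_le_wordOf (a b c : List ℕ) : a.length ≤ (wordOf a b c).length := by
  have h1 := length_fstF_sndF_le (wordOf a b c)
  have h2 := length_fstF_sndF_le (fstF (wordOf a b c))
  have : fstF (fstF (wordOf a b c)) = ones a.length := by
    rw [show fstF (wordOf a b c) = z1F (wordOf a b c) from rfl, z1F_wordOf, encodeUnaryList_eq, fstF_boolPair]
  rw [this, List.length_replicate] at h2
  omega

/-- A concatenation of runs of ones is the run of the sum. [folklore] -/
theorem ccat_ones (f : ℕ → ℕ) : ∀ K, ccat (fun j => ones (f j)) K = ones (∑ j ∈ range K, f j)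
  | 0 => by simp
  | K + 1 => by rw [ccat_succ, ccat_ones f K, sum_range_succ, ones, ones, ones, ← List.replicate_add]

/-- A concatenation is empty iff all its pieces are. [folklore] -/
theorem ccat_eq_nil_iff (g : ℕ → List Bool) : ∀ K, ccat g K = [] ↔ ∀ j < K, g j = []
  | 0 => by simp
  | K + 1 => by
    rw [ccat_succ, List.append_eq_nil_iff, ccat_eq_nil_iff g K]
    constructor
    · rintro ⟨h1, h2⟩ j hj
      rcases Nat.lt_succ_iff_lt_or_eq.1 hj with h | rfl
      · exact h1 j h
      · exact h2
    · intro h; exact ⟨fun j hj => h j (by omega), h K (by omega)⟩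

/-- **Value of a fold with `1ˣ`-valued pieces over `K = |μ'|` rounds** on a genuine word
(quadratic clip, which also covers linearly bounded pieces). [folklore] -/
theorem foldN_wordOf {piece : List Bool → List Bool} {C : ℕ} (a b c : List ℕ) {f : ℕ → ℕ}
    (hval : ∀ i, piece (pargOf a b c i) = ones (f i))
    (hlen : ∀ i < a.length, f i ≤ C * ((wordOf a b c).length + 1) ^ 2) :
    (sndPow 2 ∘ foldLoop appF (clip2F C piece) X ∘ initN) (wordOf a b c) = ones (∑ i ∈ range a.length, f i) := by
  rw [Function.comp_apply, Function.comp_apply, initN_wordOf,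
    foldLoop_apply _ _ (by rw [eval_X]; exact length_le_wordOf a b c), foldAcc_clip2F, foldAcc_appF, List.nil_append]
  · simp only [sndPow_succ_boolPair, sndPow_zero_boolPair, Nat.zero_add]
    rw [show (fun j => piece (boolPair (wordOf a b c) (ones j))) = fun j => ones (f j) from funext fun j => hval j, ccat_ones]
  · intro j _ hj
    rw [Nat.zero_add] at hj
    show (piece (pargOf a b c j)).length ≤ _
    rw [hval, List.length_replicate]; exact hlen j hj

/-- **Value of a fold with mark-valued pieces over `r = |μ'| - 1` rounds** on a genuine word: the
concatenated marks. [folklore] -/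
theorem foldR_wordOf {piece : List Bool → List Bool} (a b c : List ℕ)
    (hlen : ∀ i, (piece (pargOf a b c i)).length ≤ 1) :
    (sndPow 2 ∘ foldLoop appF (clipF 1 piece) X ∘ initR) (wordOf a b c) =
      ccat (fun j => piece (pargOf a b c j)) (a.length - 1) := by
  rw [Function.comp_apply, Function.comp_apply, initR_wordOf,
    foldLoop_apply _ _ (by rw [eval_X]; exact (Nat.sub_le _ _).trans (length_le_wordOf a b c)), foldAcc_clipF,
    foldAcc_appF, List.nil_append]
  · simp only [sndPow_succ_boolPair, sndPow_zero_boolPair, Nat.zero_add]; rfl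
  · intro j _ _
    exact (hlen j).trans (by omega)

/-! ### Bounds on genuine items -/

/-- `nthItemFn` returns a substring: `|nthItemFn ⟨u, W⟩| ≤ |W|`. (Statement-identical to a local
copy in `PPolyTuringClosure.lean`; the lemma's natural home is `HashBricks.lean` next to
`nthItemFn` — librarian consolidation candidate.) [folklore] -/
theorem length_nthItemFn_boolPair_le (u W : List Bool) : (nthItemFn (boolPair u W)).length ≤ W.length := by
  rw [nthItemFn_boolPair]
  exact (Lemma3FP.length_fstF_le _).trans (length_iterate_sndF_le _ _)

/-- `|zF k w| ≤ |w|`. [folklore] -/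
theorem length_zF_le (k : ℕ) (w : List Bool) : (zF k w).length ≤ w.length := by
  unfold zF z1F z2F z3F
  split_ifs
  · exact Lemma3FP.length_fstF_le w
  · exact (Lemma3FP.length_fstF_le _).trans (Lemma3FP.length_sndF_le w)
  · exact (Lemma3FP.length_sndF_le _).trans (Lemma3FP.length_sndF_le w)

/-- Entries of a genuine instance are at most the length of its code. [folklore] -/
theorem getD_le_wordOf (k : ℕ) (a b c : List ℕ) (i : ℕ) : (lst k a b c).getD i 0 ≤ (wordOf a b c).length := by
  have h := length_nthItemFn_boolPair_le (ones i) (sndF (zF k (wordOf a b c)))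
  have e : nthItemFn (boolPair (ones i) (sndF (zF k (wordOf a b c)))) = ones ((lst k a b c).getD i 0) := by
    rw [zF_wordOf, nthItemFn_code]
  rw [e, List.length_replicate] at h
  exact h.trans ((Lemma3FP.length_sndF_le _).trans (length_zF_le k _))

/-- The item section of a unary list code has length `2 ∑ l + 2 |l|`. [folklore] -/
theorem length_encList_map_ones (l : List ℕ) : (encList (l.map ones)).length = 2 * l.sum + 2 * l.length := by
  induction l with
  | nil => rfl
  | cons x l ih =>
    rw [List.map_cons, encList_cons_eq, List.length_append, ih, length_frame, List.length_replicate, List.sum_cons,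
      List.length_cons]
    ring

/-- `tri (k + 1) = tri k + (k + 1)` (natural home: next to `tri` in `KroneckerXRayCodes.lean`;
kept here to leave that accepted file untouched). [folklore] -/
theorem tri_succ (k : ℕ) : tri (k + 1) = tri k + (k + 1) := by
  unfold tri
  have h1 : (k + 1) * (k + 1 + 1) = k * (k + 1) + 2 * (k + 1) := by ring
  rw [h1, Nat.add_mul_div_left _ _ Nat.two_pos]

/-! ### The tests -/

/-- "the header of list 1 is non-empty" (`|μ'| ≠ 0`). [folklore] -/
def t0F : List Bool → List Bool := notFn (isNilFn ∘ fstF ∘ z1F)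
/-- "headers of lists 1 and `k` are equal" (equal lengths). [folklore] -/
def hdrEqF (k : ℕ) : List Bool → List Bool := eqPairFn ∘ fanoutFn (fstF ∘ z1F) (fstF ∘ zF k)
/-- "item sections of lists 1 and `k` have equal length" (equal sums, given equal lengths). [folklore] -/
def bodyEqF (k : ℕ) : List Bool → List Bool := eqPairFn ∘ fanoutFn (onesFn ∘ sndF ∘ z1F) (onesFn ∘ sndF ∘ zF k)
/-- On `⟨w, 1ⁱ⟩`: `1^{i (μ'_i + ν'_i + ρ'_i)}`. [folklore] -/
def momPiece : List Bool → List Bool :=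
  umulFn ∘ fanoutFn sndF (appendFn ∘ fanoutFn (itemP 1) (appendFn ∘ fanoutFn (itemP 2) (itemP 3)))
/-- `1^{∑ i (μ'_i + ν'_i + ρ'_i)}`. [folklore] -/
def momF : List Bool → List Bool := sndPow 2 ∘ foldLoop appF (clip2F 3 momPiece) X ∘ initN
/-- `1^{∑ μ'}`. [folklore] -/
def sumAF : List Bool → List Bool := sndPow 2 ∘ foldLoop appF (clip2F 1 (itemP 1)) X ∘ initN
/-- **The moment test** `[∑ i (μ'_i + ν'_i + ρ'_i) = r ∑ μ']`. [cite: FischerIkenmeyer2020, Theorem 5] -/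
def momEqF : List Bool → List Bool := eqPairFn ∘ fanoutFn (onesFn ∘ momF) (umulFn ∘ fanoutFn rF sumAF)
/-- On `⟨w, 1ⁱ⟩`: the violation mark of antitonicity of list `k` at `i`: `[1]` if
`l_i + (r - i) < l_{i+1}`, else `ε`. [folklore] -/
def violPiece (k : ℕ) : List Bool → List Bool :=
  iteFn (ltLenF ∘ fanoutFn (appendFn ∘ fanoutFn (itemP k) rMinusIP) (itemSuccP k)) (fun _ => [true]) (fun _ => [])
/-- **The antitonicity test** of the lifted marginal of list `k`: no violation mark. [folklore] -/
def antiF (k : ℕ) : List Bool → List Bool := isNilFn ∘ sndPow 2 ∘ foldLoop appF (clipF 1 (violPiece k)) X ∘ initR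

/-- **The admissibility test.** [cite: FischerIkenmeyer2020, Theorem 5 (hypotheses)] -/
def admissibleF : List Bool → List Bool :=
  andFn t0F (andFn (hdrEqF 2) (andFn (hdrEqF 3) (andFn (bodyEqF 2) (andFn (bodyEqF 3)
    (andFn momEqF (andFn (antiF 1) (andFn (antiF 2) (antiF 3))))))))

/-! ### One-bit and `FP` -/

/-- `t0F` is one-bit on every input. [folklore] -/
theorem oneBit_t0F : OneBit t0F := oneBit_notFn (oneBit_isNilFn.comp _)
/-- `hdrEqF` is one-bit on every input. [folklore] -/
theorem oneBit_hdrEqF (k : ℕ) : OneBit (hdrEqF k) := oneBit_eqPairFn.comp _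
/-- `bodyEqF` is one-bit on every input. [folklore] -/
theorem oneBit_bodyEqF (k : ℕ) : OneBit (bodyEqF k) := oneBit_eqPairFn.comp _
/-- `momEqF` is one-bit on every input. [folklore] -/
theorem oneBit_momEqF : OneBit momEqF := oneBit_eqPairFn.comp _
/-- `antiF` is one-bit on every input. [folklore] -/
theorem oneBit_antiF (k : ℕ) : OneBit (antiF k) := oneBit_isNilFn.comp _

/-- The admissibility test is one-bit. [folklore] -/
theorem oneBit_admissibleF : OneBit admissibleF :=
  oneBit_andFn oneBit_t0F (oneBit_andFn (oneBit_hdrEqF 2) (oneBit_andFn (oneBit_hdrEqF 3) (oneBit_andFn (oneBit_bodyEqF 2)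
    (oneBit_andFn (oneBit_bodyEqF 3) (oneBit_andFn oneBit_momEqF (oneBit_andFn (oneBit_antiF 1)
      (oneBit_andFn (oneBit_antiF 2) (oneBit_antiF 3))))))))

/-- `t0F`: membership in `FP` by composition. [cite: AroraBarak2009, §1.3] -/
theorem t0F_mem_FP : t0F ∈ FP := notFn_mem_FP (comp_mem_FP isNilFn_mem_FP (comp_mem_FP fstF_mem_FP (zF_mem_FP 1)))
/-- `hdrEqF`: membership in `FP` by composition. [cite: AroraBarak2009, §1.3] -/
theorem hdrEqF_mem_FP (k : ℕ) : hdrEqF k ∈ FP :=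
  comp_mem_FP eqPairFn_mem_FP (fanoutFn_mem_FP (comp_mem_FP fstF_mem_FP (zF_mem_FP 1)) (comp_mem_FP fstF_mem_FP (zF_mem_FP k)))
/-- `bodyEqF`: membership in `FP` by composition. [cite: AroraBarak2009, §1.3] -/
theorem bodyEqF_mem_FP (k : ℕ) : bodyEqF k ∈ FP :=
  comp_mem_FP eqPairFn_mem_FP (fanoutFn_mem_FP (comp_mem_FP onesFn_mem_FP (comp_mem_FP sndF_mem_FP (zF_mem_FP 1)))
    (comp_mem_FP onesFn_mem_FP (comp_mem_FP sndF_mem_FP (zF_mem_FP k))))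
/-- `momPiece`: membership in `FP` by composition. [cite: AroraBarak2009, §1.3] -/
theorem momPiece_mem_FP : momPiece ∈ FP :=
  comp_mem_FP umulFn_mem_FP (fanoutFn_mem_FP sndF_mem_FP (comp_mem_FP appendFn_mem_FP (fanoutFn_mem_FP (itemP_mem_FP 1)
    (comp_mem_FP appendFn_mem_FP (fanoutFn_mem_FP (itemP_mem_FP 2) (itemP_mem_FP 3))))))
/-- `momF`: membership in `FP` by composition. [cite: AroraBarak2009, §1.3] -/
theorem momF_mem_FP : momF ∈ FP :=
  comp_mem_FP (sndPow_mem_FP 2) (comp_mem_FP (foldLoop_clip2F_mem_FP 3 appF_mem_FP length_appF_le momPiece_mem_FP _) initN_mem_FP)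
/-- `sumAF`: membership in `FP` by composition. [cite: AroraBarak2009, §1.3] -/
theorem sumAF_mem_FP : sumAF ∈ FP :=
  comp_mem_FP (sndPow_mem_FP 2) (comp_mem_FP (foldLoop_clip2F_mem_FP 1 appF_mem_FP length_appF_le (itemP_mem_FP 1) _) initN_mem_FP)
/-- `momEqF`: membership in `FP` by composition. [cite: AroraBarak2009, §1.3] -/
theorem momEqF_mem_FP : momEqF ∈ FP :=
  comp_mem_FP eqPairFn_mem_FP (fanoutFn_mem_FP (comp_mem_FP onesFn_mem_FP momF_mem_FP)
    (comp_mem_FP umulFn_mem_FP (fanoutFn_mem_FP rF_mem_FP sumAF_mem_FP)))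
/-- `violPiece`: membership in `FP` by composition. [cite: AroraBarak2009, §1.3] -/
theorem violPiece_mem_FP (k : ℕ) : violPiece k ∈ FP :=
  iteFn_mem_FP (comp_mem_FP ltLenF_mem_FP (fanoutFn_mem_FP (comp_mem_FP appendFn_mem_FP (fanoutFn_mem_FP (itemP_mem_FP k)
    rMinusIP_mem_FP)) (itemSuccP_mem_FP k))) (const_mem_FP _) (const_mem_FP _)
/-- `antiF`: membership in `FP` by composition. [cite: AroraBarak2009, §1.3] -/
theorem antiF_mem_FP (k : ℕ) : antiF k ∈ FP :=
  comp_mem_FP isNilFn_mem_FP (comp_mem_FP (sndPow_mem_FP 2) (comp_mem_FP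
    (foldLoop_clipF_mem_FP 1 appF_mem_FP length_appF_le (violPiece_mem_FP k) _) initR_mem_FP))

/-- **`admissibleF ∈ FP`.** [cite: AroraBarak2009, §1.3] -/
theorem admissibleF_mem_FP : admissibleF ∈ FP :=
  andFn_mem_FP t0F_mem_FP (andFn_mem_FP (hdrEqF_mem_FP 2) (andFn_mem_FP (hdrEqF_mem_FP 3) (andFn_mem_FP (bodyEqF_mem_FP 2)
    (andFn_mem_FP (bodyEqF_mem_FP 3) (andFn_mem_FP momEqF_mem_FP (andFn_mem_FP (antiF_mem_FP 1)
      (andFn_mem_FP (antiF_mem_FP 2) (antiF_mem_FP 3))))))))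

/-! ### Values of the tests on a genuine word -/

section Vals

variable (a b c : List ℕ)

/-- Value of `t0F`. [folklore] -/
theorem t0F_wordOf : t0F (wordOf a b c) = [decide (a.length ≠ 0)] := by
  have h : (isNilFn ∘ fstF ∘ z1F) (wordOf a b c) = [decide (a.length = 0)] := by
    simp only [Function.comp_apply, z1F_wordOf, encodeUnaryList_eq, fstF_boolPair, isNilFn]
    congr 1; apply Bool.decide_congr
    exact ⟨fun h => by simpa using congrArg List.length h, fun h => by rw [h]; rfl⟩
  rw [t0F, notFn_apply h]
  by_cases h0 : a.length = 0 <;> simp [h0]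

/-- Value of `hdrEqF`. [folklore] -/
theorem hdrEqF_wordOf (k : ℕ) : hdrEqF k (wordOf a b c) = [decide (a.length = (lst k a b c).length)] := by
  simp only [hdrEqF, Function.comp_apply, fanoutFn_apply, z1F_wordOf, zF_wordOf, encodeUnaryList_eq, fstF_boolPair,
    eqPairFn_boolPair]
  congr 1; exact Bool.decide_congr List.replicate_left_inj

/-- Value of `bodyEqF`. [folklore] -/
theorem bodyEqF_wordOf (k : ℕ) : bodyEqF k (wordOf a b c) =
    [decide (2 * a.sum + 2 * a.length = 2 * (lst k a b c).sum + 2 * (lst k a b c).length)] := by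
  simp only [bodyEqF, Function.comp_apply, fanoutFn_apply, z1F_wordOf, zF_wordOf, encodeUnaryList_eq, sndF_boolPair,
    eqPairFn_boolPair, onesFn, unaryEncodeNat_eq_ones', length_encList_map_ones]
  congr 1; exact Bool.decide_congr List.replicate_left_inj

/-- Value of `momPiece`. [folklore] -/
theorem momPiece_pargOf (i : ℕ) : momPiece (pargOf a b c i) = ones (i * (a.getD i 0 + b.getD i 0 + c.getD i 0)) := by
  rw [momPiece, Function.comp_apply, fanoutFn_apply, sndF_pargOf, Function.comp_apply, fanoutFn_apply, itemP_pargOf,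
    Function.comp_apply, fanoutFn_apply, itemP_pargOf, itemP_pargOf, appendFn_boolPair, appendFn_boolPair, lst_one, lst_two,
    lst_three]
  have e : ones (a.getD i 0) ++ (ones (b.getD i 0) ++ ones (c.getD i 0)) = ones (a.getD i 0 + b.getD i 0 + c.getD i 0) := by
    rw [ones, ones, ones, ← List.replicate_add, ← List.replicate_add, Nat.add_assoc]
  rw [e, umulFn_boolPair]

/-- Value of `momF`. [folklore] -/
theorem momF_wordOf : momF (wordOf a b c) = ones (∑ i ∈ range a.length, i * (a.getD i 0 + b.getD i 0 + c.getD i 0)) := by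
  apply foldN_wordOf a b c (momPiece_pargOf a b c)
  intro i hi
  have h1 := getD_le_wordOf 1 a b c i
  have h2 := getD_le_wordOf 2 a b c i
  have h3 := getD_le_wordOf 3 a b c i
  simp only [lst_one, lst_two, lst_three] at h1 h2 h3
  have hL := length_le_wordOf a b c
  nlinarith

/-- Value of `sumAF`. [folklore] -/
theorem sumAF_wordOf : sumAF (wordOf a b c) = ones a.sum := by
  rw [sumAF, foldN_wordOf a b c (f := fun i => a.getD i 0) (by intro i; simpa using itemP_pargOf 1 a b c i)
    (fun i _ => by have := getD_le_wordOf 1 a b c i; simp only [lst_one] at this; nlinarith),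
    sum_range_getD_eq_sum a le_rfl]

/-- **Value of the moment test.** [folklore] -/
theorem momEqF_wordOf : momEqF (wordOf a b c) =
    [decide (∑ i ∈ range a.length, i * (a.getD i 0 + b.getD i 0 + c.getD i 0) = (a.length - 1) * a.sum)] := by
  simp only [momEqF, Function.comp_apply, fanoutFn_apply, momF_wordOf, sumAF_wordOf, rF_wordOf, umulFn_boolPair, onesFn,
    unaryEncodeNat_eq_ones', List.length_replicate, eqPairFn_boolPair]
  congr 1; exact Bool.decide_congr List.replicate_left_inj

/-- The violation predicate of list `l` at `i` for `r`. [folklore] -/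
def Viol (l : List ℕ) (r i : ℕ) : Prop := l.getD i 0 + (r - i) < l.getD (i + 1) 0

/-- `Viol` is decidable. [folklore] -/
instance (l : List ℕ) (r i : ℕ) : Decidable (Viol l r i) := by unfold Viol; infer_instance

/-- Value of `violPiece`. [folklore] -/
theorem violPiece_pargOf (k i : ℕ) :
    violPiece k (pargOf a b c i) = if Viol (lst k a b c) (a.length - 1) i then [true] else [] := by
  have h : (ltLenF ∘ fanoutFn (appendFn ∘ fanoutFn (itemP k) rMinusIP) (itemSuccP k)) (pargOf a b c i) =
      [decide (Viol (lst k a b c) (a.length - 1) i)] := by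
    simp only [Function.comp_apply, fanoutFn_apply, itemP_pargOf, rMinusIP_pargOf, itemSuccP_pargOf, appendFn_boolPair,
      ltLenF_boolPair, List.length_append, List.length_replicate]
    rfl
  rw [violPiece, iteFn_apply h]
  by_cases hv : Viol (lst k a b c) (a.length - 1) i <;> simp [hv]

/-- **Value of the antitonicity test.** [folklore] -/
theorem antiF_wordOf (k : ℕ) : antiF k (wordOf a b c) = [decide (∀ i < a.length - 1, ¬ Viol (lst k a b c) (a.length - 1) i)] := by
  have hl : ∀ i, (violPiece k (pargOf a b c i)).length ≤ 1 := fun i => by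
    rw [violPiece_pargOf]; split_ifs <;> simp
  rw [antiF, Function.comp_apply, foldR_wordOf a b c hl, isNilFn]
  congr 1; apply Bool.decide_congr
  rw [ccat_eq_nil_iff]
  apply forall_congr'; intro i; apply imp_congr_right; intro _
  rw [violPiece_pargOf]
  split_ifs with h <;> simp [h]

end Vals

/-! ### The test decides admissibility -/

/-- Antitonicity of a lifted marginal as the finite test. [folklore] -/
theorem antitone_lift_iff {l : List ℕ} {r : ℕ} (hl : l.length = r + 1) :
    Antitone (fun i => tri (r - i) + l.getD i 0) ↔ ∀ i < r, ¬ Viol l r i := by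
  rw [antitone_iff_forall_succ_le (r := r) (fun i hi => by
    rw [show r - i = 0 by omega, List.getD_eq_default _ _ (by omega)]; rfl)]
  constructor
  · intro h i hi
    have := h i hi.le
    rw [Viol, not_lt]
    have e : tri (r - i) = tri (r - (i + 1)) + (r - i) := by
      rw [show r - i = r - (i + 1) + 1 by omega, tri_succ]
    omega
  · intro h i hi
    rcases hi.lt_or_eq with hlt | rfl
    · have := h i hlt
      rw [Viol, not_lt] at this
      have e : tri (r - i) = tri (r - (i + 1)) + (r - i) := by
        rw [show r - i = r - (i + 1) + 1 by omega, tri_succ]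
      show tri (r - (i + 1)) + l.getD (i + 1) 0 ≤ tri (r - i) + l.getD i 0
      omega
    · show tri (i - (i + 1)) + l.getD (i + 1) 0 ≤ tri (i - i) + l.getD i 0
      rw [List.getD_eq_default _ _ (by omega), show i - (i + 1) = 0 by omega, Nat.sub_self]
      exact Nat.le_add_right _ _

/-- `liftX` in the form of `antitone_lift_iff`. [folklore] -/
theorem liftX_funext (r : ℕ) (μ' : List ℕ) : liftX r μ' = fun i => tri (r - i) + μ'.getD i 0 := funext (liftX_eq r μ')
/-- `liftY_funext` (auxiliary). [folklore] -/
theorem liftY_funext (r : ℕ) (ν' : List ℕ) : liftY r ν' = fun i => tri (r - i) + ν'.getD i 0 := funext (liftY_eq r ν')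
/-- `liftZ_funext` (auxiliary). [folklore] -/
theorem liftZ_funext (r : ℕ) (ρ' : List ℕ) : liftZ r ρ' = fun i => tri (r - i) + ρ'.getD i 0 := funext (liftZ_eq r ρ')

/-- **The admissibility test is correct**: on the code of `(μ', ν', ρ')` it answers `[1]` iff
the 2D-X-RAY instance is admissible with `r + 1 = |μ'|`.
[cite: FischerIkenmeyer2020, Theorem 5 (hypotheses)] -/
theorem admissibleF_wordOf_eq_true_iff (a b c : List ℕ) :
    admissibleF (wordOf a b c) = [true] ↔ XRayAdmissible (a.length - 1) a b c := by
  rw [admissibleF, andFn_apply (t0F_wordOf a b c) (andFn_apply (hdrEqF_wordOf a b c 2) (andFn_apply (hdrEqF_wordOf a b c 3)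
    (andFn_apply (bodyEqF_wordOf a b c 2) (andFn_apply (bodyEqF_wordOf a b c 3) (andFn_apply (momEqF_wordOf a b c)
    (andFn_apply (antiF_wordOf a b c 1) (andFn_apply (antiF_wordOf a b c 2) (antiF_wordOf a b c 3))))))))]
  simp only [lst_one, lst_two, lst_three, List.cons.injEq, and_true, Bool.and_eq_true, decide_eq_true_eq]
  constructor
  · rintro ⟨h0, h1b, h1c, h2b, h2c, h3, h4, h5, h6⟩
    have hn : a.length = a.length - 1 + 1 := by omega
    refine ⟨hn, by omega, by omega, by omega, by omega, ?_, ?_, ?_, ?_⟩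
    · rw [← hn]; exact h3
    · rw [liftX_funext, antitone_lift_iff hn]; exact h4
    · rw [liftY_funext, antitone_lift_iff (by omega)]; exact h5
    · rw [liftZ_funext, antitone_lift_iff (by omega)]; exact h6
  · intro h
    have hn := h.length₁
    refine ⟨by omega, by rw [h.length₂]; exact hn, by rw [h.length₃]; exact hn, by rw [h.sum₂, h.length₂]; omega,
      by rw [h.sum₃, h.length₃]; omega, ?_, ?_, ?_, ?_⟩
    · have := h.moment; rwa [← hn] at this
    · have := h.antitoneX; rwa [liftX_funext, antitone_lift_iff hn] at this
    · have := h.antitoneY; rwa [liftY_funext, antitone_lift_iff (by rw [h.length₂])] at this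
    · have := h.antitoneZ; rwa [liftZ_funext, antitone_lift_iff (by rw [h.length₃])] at this

end XRayKron

end Literature.Barriers.ValiantsHypothesis
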